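import Summits.QuantumFields.YangMills.Theorems.BalabanUVNodesN15TwoSpacingGluingCutRowsDefect
import Summits.QuantumFields.YangMills.Theorems.BalabanUVNodesN15TwoSpacingGluingInputLocalized
import Summits.QuantumFields.YangMills.Theorems.BalabanUVNodesN15TwoGridLocality
import HarnessLib

/-!
# THE GLUING STEP AT TWO LATTICE SPACINGS, XXXIII: THE TWO NONLOCAL η-DEFECT SOCKETS OF THE REMAINDER ROW — `𝔇(M_{h′}N_L′N′, M_hN_LN)` FROM THE CUT PAIR BY LEIBNIZ, AND
# `𝔇(N_L′, N_L)∘(M_h M_χ N)` FROM THE PIECES OF `N_L = aQ*Q − ∂Π∂*` (dag-n15-c g12, FILE 75; N15 = NE2, s1 «background-layer OPERATOR ingredient»)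

Cell `pub-ymgap`, seat `pub-ymgap-dag-n15-c` (R134 (a); HUMAN RULING D-0062), generation 12.  `bears_on: R4∕N15 · K3⁷ SpineGivenEndpointR13SepCoPH (stmt-QuantumFields-20544)`.
Filed `--supports stmt-QuantumFields-20544 --as helper` — COUNT-NEUTRAL.  Theorems only (0 `def`, 0 `sorry`); generic in the geometry `g`, the block maps and the pairing `π`.  Imports BY
NAME FILE 71 (through it FILE 46 `hasMaj_idef_mulOp_comp_loc`, `hasMaj_diag_comp`, `idef_comp`), FILE 60 (`hasMaj_comp_exp_in`), dag-n15-a part 42 (`hasMaj_smul_ofBlocks`); nothing in the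
tree is modified.

WHAT.  The two operator-side sockets `hD3` (r₃) and `hT3` (r_B) of FILE 71 `hasMaj_idef_commOp_comp_of_add_cut` ∕ FILE 74 `hasMaj_idef_commOp_comp_cover_of` reduced to rows the cube
programmes print:
* §1 ★★ `hasMaj_idef_mulOp_nonlocal_of_cut` — `r₃`: since `M_h = M_hM_χ` at both spacings, `𝔇(M_{h′}∘N_L′∘N′, M_h∘N_L∘N) = 𝔇(M_{h′}∘(M_{χ′}N_L′N′), M_h∘(M_χN_LN))`, and Leibniz (FILE 46) with
  `|h′| ≤ 1`, the fit `|h′ − h∘π| ≤ o`, the OUTPUT-CUT convolution row `M_χ∘N_L∘N ≤ 1_□1_□θe^{−δd}` (dag-n15-a N-IIi ∕ P-IIe (β′)) and ITS defect `𝔇(M_{χ′}N_L′N′, M_χN_LN) ≤ 1_□1_□re^{−δd}`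
  (dag-n15-a N-IIk ∕ its transplant) gives `≤ 1_□1_□(r + oθ)e^{−δd}`;
* §2 ★★ `hasMaj_idef_nonlocalPart_comp` — `r_B`: for `N_L = a·QQ + (−V)` (`QQ = Q*Q`, `V = ∂Π∂*`): `𝔇(N_L′, N_L)∘X = a·𝔇(QQ′, QQ)∘X − 𝔇(V′, V)∘X` with `X = M_h∘(M_χN)`; the Landau defect
  `𝔇(V′, V) ≤ c_Ve^{−ρ₁d}` (dag-n15-a `hasMaj_landauDefect_family`, an OPERATOR defect) is convolved with the two-sided row of `X` (`|h| ≤ 1`, cut row `β`), the block-averaging defect stays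
  a displayed COMPOSITE `𝔇(QQ′, QQ)∘X ≤ 1_□(y′)r_Qe^{−ρd}` (it exists only on differentiable inputs — dag-n15-a part 43 `hasMaj_qvRe_pull_sub_comp`): `≤ 1_□(y′)(|a|r_Q + c_Vβc_r)e^{−ρd}`.

HONEST FRAMING ∕ LIMITS.  Operator algebra + block-majorant bookkeeping; the two-grid DIFFERENCE TEMPLATE of [B9] Thm 3.14 pp.426–427 applied to [B6] §2's remainder row (2.92)–(2.93)
p.239 at the level of SHAPES; nothing of [B5]∕[B6]∕[B9] asserted.  NE2⁺ NOT PRINTED, NOT proved; N15 NOT discharged; counts of record UNMOVED (typed 28∕28 · discharged 5∕27); one finite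
𝕋⁴ at fixed ε per index — NOT infinite volume, NOT OS on ℝ⁴, NOT a mass gap, NOT Clay; R4 closes the conditional finite-𝕋⁴ rung `BalabanLadder.UV` only.  Restate-immune.
-/

noncomputable section

namespace Summit.QuantumFields.YangMills.BalabanUVNodes.N15.Gluing

open Literature.MathematicalPhysics.QuantumFieldTheory.Balaban1983to89
open Literature.MathematicalPhysics.QuantumFieldTheory.Balaban1983to89.B11SectG (BlockNorm HasMaj RowSum hasMaj_comp)
open Literature.MathematicalPhysics.QuantumFieldTheory.Balaban1983to89.T4EtaRateDefect (idef idef_apply idef_comp idef_sub idef_add idef_smul)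
open Literature.MathematicalPhysics.QuantumFieldTheory.Balaban1983to89.T4EtaRateCoeffDefect (pull pull_apply diagK diagK_nonneg hasMaj_mulOp hasMaj_idef_mulOp)
open Literature.MathematicalPhysics.QuantumFieldTheory.Balaban1983to89.B6RandomWalk (Triangle254)
open Literature.MathematicalPhysics.QuantumFieldTheory.Balaban1983to89.B6Prop26Gluing (mulOp mulOp_apply ind ind_nonneg ind_le_one)
open Summit.QuantumFields.YangMills.BalabanUVNodes.N15.TwoGrid (hasMaj_smul_ofBlocks)

variable {d : ℕ}

/-! ## §1 `r₃`: the defect of `M_h∘N_L∘N` from the output-cut pair by Leibniz -/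

section R3

variable {X X' : Type} [Fintype X] [Fintype X'] {g : B6.Geometry} (blk : X → g.Site) (π : X' → X)

/-- ★★ **`𝔇(M_{h′}∘N_L′∘N′, M_h∘N_L∘N) ≤ 1_□1_□(r + oθ)e^{−δd}`** from `M_h = M_hM_χ` (both spacings), `|h′| ≤ 1`, the fit `|h′ − h∘π| ≤ o`, the output-cut convolution row `M_χN_LN ≤ 1_□1_□θe^{−δd}`
and its defect `𝔇(M_{χ′}N_L′N′, M_χN_LN) ≤ 1_□1_□re^{−δd}` — FILE 46's Leibniz. [cite: Balaban1984PropagatorsII, (2.92)–(2.93) p.239 (shape); Balaban1985BackgroundPropagators, Thm 3.14 pp.426–427 (difference template)] -/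
theorem hasMaj_idef_mulOp_nonlocal_of_cut {NL N : (X → ℝ) →ₗ[ℝ] (X → ℝ)} {NL' N' : (X' → ℝ) →ₗ[ℝ] (X' → ℝ)} {h χ : X → ℝ} {h' χ' : X' → ℝ} {S : Set g.Site} {θ r o δ : ℝ}
    (ho : 0 ≤ o) (hcut : mulOp h ∘ₗ mulOp χ = mulOp h) (hcut' : mulOp h' ∘ₗ mulOp χ' = mulOp h') (hh' : ∀ x', |h' x'| ≤ 1) (hfit : ∀ x', |h' x' - h (π x')| ≤ o)
    (hY : HasMaj (BlockNorm.ofBlocks g blk) (BlockNorm.ofBlocks g blk) (mulOp χ ∘ₗ (NL ∘ₗ N)) (fun y y' => ind S y * ind S y' * (θ * Real.exp (-(δ * g.dist y y')))))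
    (hIY : HasMaj (BlockNorm.ofBlocks g blk) (BlockNorm.ofBlocks g (blk ∘ π)) (idef (pull π) (pull π) (mulOp χ' ∘ₗ (NL' ∘ₗ N')) (mulOp χ ∘ₗ (NL ∘ₗ N)))
      (fun y y' => ind S y * ind S y' * (r * Real.exp (-(δ * g.dist y y'))))) :
    HasMaj (BlockNorm.ofBlocks g blk) (BlockNorm.ofBlocks g (blk ∘ π)) (idef (pull π) (pull π) (mulOp h' ∘ₗ (NL' ∘ₗ N')) (mulOp h ∘ₗ (NL ∘ₗ N)))
      (fun y y' => ind S y * ind S y' * ((1 * r + o * θ) * Real.exp (-(δ * g.dist y y')))) := by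
  rw [show mulOp h ∘ₗ (NL ∘ₗ N) = mulOp h ∘ₗ (mulOp χ ∘ₗ (NL ∘ₗ N)) by rw [← LinearMap.comp_assoc (NL ∘ₗ N), hcut],
    show mulOp h' ∘ₗ (NL' ∘ₗ N') = mulOp h' ∘ₗ (mulOp χ' ∘ₗ (NL' ∘ₗ N')) by rw [← LinearMap.comp_assoc (NL' ∘ₗ N'), hcut']]
  exact hasMaj_idef_mulOp_comp_loc blk π zero_le_one ho hh' hfit hY hIY

end R3

/-! ## §2 `r_B`: the composite `𝔇(N_L′, N_L)∘(M_h M_χ N)` from the pieces of `N_L = a·QQ − V` -/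

section RB

variable {X X' : Type} [Fintype X] [Fintype X'] {g : B6.Geometry} (blk : X → g.Site) (π : X' → X) {σ cr : ℝ}

omit [Fintype X] [Fintype X'] in
/-- `𝔇(a·QQ′ + (−V′), a·QQ + (−V)) = a·𝔇(QQ′, QQ) − 𝔇(V′, V)`. [folklore] -/
theorem idef_smul_add_neg (a : ℝ) (QQ' V' : (X' → ℝ) →ₗ[ℝ] (X' → ℝ)) (QQ V : (X → ℝ) →ₗ[ℝ] (X → ℝ)) :
    idef (pull π) (pull π) (a • QQ' + (-V')) (a • QQ + (-V)) = a • idef (pull π) (pull π) QQ' QQ - idef (pull π) (pull π) V' V := by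
  ext f x
  simp only [idef, LinearMap.sub_apply, LinearMap.add_apply, LinearMap.smul_apply, LinearMap.neg_apply, LinearMap.comp_apply, Pi.sub_apply, Pi.add_apply,
    Pi.smul_apply, Pi.neg_apply, smul_eq_mul, map_add, map_smul, map_neg]
  ring

/-- ★★ **`𝔇(N_L′, N_L)∘(M_h∘(M_χN)) ≤ 1_□(y′)·(|a|r_Q + c_Vβc_r)·e^{−ρd}`** for `N_L = a·QQ + (−V)`: the Landau part's OPERATOR defect `𝔇(V′, V) ≤ c_Ve^{−ρ₁d}` convolved with the two-sided
row of `M_h∘(M_χN)` (`|h| ≤ 1`, cut row `β`, `ρ ≤ δ`, `ρ + σ ≤ ρ₁`); the block-averaging part as the displayed composite `𝔇(QQ′, QQ)∘(M_h∘(M_χN)) ≤ 1_□(y′)r_Qe^{−ρd}`.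
[cite: Balaban1984PropagatorsI, (1.69) p.29, (1.126) p.38 (shapes); Balaban1985BackgroundPropagators, Thm 3.14 pp.426–427 (difference template)] -/
theorem hasMaj_idef_nonlocalPart_comp (htri : Triangle254 g) (hd : ∀ a b : g.Site, 0 ≤ g.dist a b) (hrow : RowSum g σ cr) {QQ V N : (X → ℝ) →ₗ[ℝ] (X → ℝ)}
    {QQ' V' : (X' → ℝ) →ₗ[ℝ] (X' → ℝ)} {h χ : X → ℝ} {S : Set g.Site} {a rQ cV β δ ρ ρ₁ : ℝ} (hrQ : 0 ≤ rQ) (hcV : 0 ≤ cV) (hβ : 0 ≤ β) (hρ : 0 ≤ ρ) (hρδ : ρ ≤ δ)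
    (hρ₁ : ρ + σ ≤ ρ₁) (hh : ∀ x, |h x| ≤ 1)
    (hGc : HasMaj (BlockNorm.ofBlocks g blk) (BlockNorm.ofBlocks g blk) (mulOp χ ∘ₗ N) (fun y y' => ind S y * ind S y' * (β * Real.exp (-(δ * g.dist y y')))))
    (hV : HasMaj (BlockNorm.ofBlocks g blk) (BlockNorm.ofBlocks g (blk ∘ π)) (idef (pull π) (pull π) V' V) (fun y y' => cV * Real.exp (-(ρ₁ * g.dist y y'))))
    (hQ : HasMaj (BlockNorm.ofBlocks g blk) (BlockNorm.ofBlocks g (blk ∘ π)) (idef (pull π) (pull π) QQ' QQ ∘ₗ (mulOp h ∘ₗ (mulOp χ ∘ₗ N)))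
      (fun y y' => ind S y' * (rQ * Real.exp (-(ρ * g.dist y y'))))) :
    HasMaj (BlockNorm.ofBlocks g blk) (BlockNorm.ofBlocks g (blk ∘ π)) (idef (pull π) (pull π) (a • QQ' + (-V')) (a • QQ + (-V)) ∘ₗ (mulOp h ∘ₗ (mulOp χ ∘ₗ N)))
      (fun y y' => ind S y' * ((|a| * rQ + cV * β * cr) * Real.exp (-(ρ * g.dist y y')))) := by
  -- the two-sided row of `X = M_h∘(M_χN)`
  have hMh := hasMaj_mulOp (g := g) blk (a := h) (m := fun _ => (1 : ℝ)) (fun _ => zero_le_one) hh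
  have hX := hasMaj_diag_comp blk (fun _ => zero_le_one) hMh hGc
  have hX' : HasMaj (BlockNorm.ofBlocks g blk) (BlockNorm.ofBlocks g blk) (mulOp h ∘ₗ (mulOp χ ∘ₗ N)) (fun y y' => ind S y * ind S y' * (β * Real.exp (-(δ * g.dist y y')))) :=
    hX.mono fun y y' => le_of_eq (by ring)
  -- the Landau part
  have tV := hasMaj_comp_exp_in blk htri hd hrow hcV hβ hρ hρδ hρ₁ hV hX'
  -- the block-averaging part (displayed composite), scaled
  have tQ := hasMaj_smul_ofBlocks (g := g) (blk ∘ π) (fun y y' => mul_nonneg (ind_nonneg _ _) (mul_nonneg hrQ (Real.exp_nonneg _))) a hQ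
  rw [idef_smul_add_neg, LinearMap.sub_comp, LinearMap.smul_comp]
  refine (tQ.sub tV).mono fun y y' => le_of_eq ?_
  ring

end RB

end Summit.QuantumFields.YangMills.BalabanUVNodes.N15.Gluing

end
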